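import Summits.BirchSwinnertonDyer.BirchSwinnertonDyer.Theorems.ThetaPartnerAtTwoSignedMainConjectureCMTwoRankZeroFlatTwistFamilySiblings
import Literature.NumberTheory.EllipticCurves.TunnellThetaCoefficients
import HarnessLib

/-!
# Route `ThetaPartnerAtTwo`, crux K2r0P `SignedMainConjectureCMTwoRankZeroOfPub` (stmt-BirchSwinnertonDyer-24945),
# line `rankzero` v14/v15, stub (μ♭)_A: the family node FROM PRINT AND BSD DATA — level-16 siblings
# (`N ≡ 1 (mod 8)`, `ord₂(#Ш·∏c_ℓ) = 1`) certify (μ♭) on the whole `j`-family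

Cell `bsd-wall`, width seat `bsd-wall-tp2-p2-w4` (g7). THEOREMS ONLY (no `def`, no named fact, no `sorry`); helper
`--supports` the crux; sequel of `…FlatTwistFamilySiblings` (namespace `…Theorems.FlatTwist.Family`).

Why this file. `analyticMuFlat_family_of_pub_of_unitZone_siblings` asks for UNIT-ZONE rank-`0` members; by the census
(`Cruxes/SignedMainConjectureCMTwoRankZeroOfPub/FLAT-CENSUS-CM-RANK0-TABLE-v1.md`, CM discriminants `11, 19, 43, 67, 163`,
23 classes up to conductor `5·10⁵`) the five sporadic families have NO rank-`0` member in the unit zone (`∏c_ℓ ∈ {2, 4, 8}`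
throughout). What the census does show: members with `ord₂(#Ш·∏c) = 1` at conductor `≡ 1 (mod 8)` — the LEVEL-16 anchors of
`FlatLevelSixteen` — e.g. (census readings, not assertions) `1089e = 11²·3²` (`c = 2`, `Ш_an = 1`) in the `j₁₁`-family and
`17689d = 19²·7²` (`c = 2`, `Ш_an = 1`) in the `j₁₉`-family; for `43, 67, 163` the census members have `c ∈ {4, 8}` (levels
`64, 256`, numerical symbol witnesses `[5/64]`, `[1/64]`, `[1/256]` in the table), served by `analyticMuFlat_of_j_eq_of_siblings`.

* §1 `conductorNorm_twist_mod_eight` — `N_{A₁} = p²·d₁² ≡ 1 (mod 8)` for a square-free twist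
  `A₁ = C₁ • W^{(d₁)}` (`d₁ ≡ 1 (mod 4)`, `p ∤ d₁`) of an anchor of conductor `p²`, `p` odd (tree `conductorNorm_twist_eq`, `ModularForms.sq_mod_eight_of_odd`);
* §2 `levelSixteen_certificate_of_sibling` — granted `hBF hLrat hGZK` and Abbes–Ullmo: a CM rank-`0` good-supersingular sibling
  `A₁` with `ord₂ #Ш(A₁) + ord₂ ∏c_ℓ(A₁) = 1` carries the plus certificate (`FlatLevelSixteen.exists_odd_sixteenth_of_padicValRat_eq_one`;
  `a₂(A₁) = 0` by the twisting formula, `w(A₁) = +1` in rank `0`);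
* §3 `analyticMuFlat_family_of_pub_of_levelSixteen_siblings` — THE FAMILY NODE FROM PRINT: anchor pair `(W, W′ = W^{(±p)})`
  of conductor `p²` (good supersingular at `2`, `a₂ = 0`, `Δ < 0`, `j ≠ 0, 1728`) and, for each anchor, ONE CM rank-`0` good-
  supersingular square-free sibling (parameter prime to `p`) with `ord₂(#Ш·∏c) = 1` ⟹ the registered stub
  `stub_analyticMuFlatNonUnitCMTwo` RESTRICTED TO THE FAMILY `j(A) = j(W)`, granted `hBF hmod hLrat hGZK hAU`. Reading: on the
  `j₁₁`- and `j₁₉`-families FLAT at ALL conductors follows from print plus the BSD data (`#Ш`, `∏c_ℓ`) of two rank-`0` curves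
  each (for a CM anchor `W′` is `p`-isogenous to `W`, so the second sibling may be taken in the isogeny class of the first).

Nothing about any particular curve is asserted; no certificate is computed here; (μ♭) class-wide stays open (the `j = 0` tail;
`j₄₃, j₆₇, j₁₆₃` need numerical symbol certificates); BSD is not proved by any of this.

References: Atkin–Lehner, Math. Ann. 185 (1970) Thm. 3, §6 [AtkinLehner1970]; Burungale–Flach, Camb. J. Math. (2024) Thm. 1.1
[BurungaleFlach2024]; Barrios–Roy–Sahajpal–Tallana–Tobin–Wiersema, Res. Number Theory 11 (2025) Thm. 5.1 [BarriosEtAl2025];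
Silverman *AEC* (2009) X.5 Prop. 5.4 [SilvermanAEC2009]; Abbes–Ullmo, Compositio Math. 103 (1996) Thm. A [AbbesUllmo1996];
Mazur–Tate–Teitelbaum, Invent. Math. 84 (1986) §I.8 [MazurTateTeitelbaum1986Invent]; Pollack, Duke Math. J. 118 (2003) Prop.
6.18 [Pollack2003].
-/

set_option autoImplicit false
-- the Theorems namespace of this sub repeats the summit name by design (D-0017 nested layout)
set_option linter.dupNamespace false

noncomputable section

open scoped Classical MatrixGroups ModularForm NumberField NumberTheorySymbols

open NumberField IsDedekindDomain Rat.HeightOneSpectrum CongruenceSubgroup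
  Literature.NumberTheory.EllipticCurves Literature.NumberTheory.GaloisRepresentations
  WeierstrassCurve Literature.NumberTheory.EllipticCurves.ModularForms Literature.NumberTheory.EllipticCurves.Rank1Residual
  Literature.NumberTheory.EllipticCurves.Rank1Residual.Typed
  Summit.BirchSwinnertonDyer.Rank1Residual Summit.BirchSwinnertonDyer.Rank1Residual.Supersingular

namespace Summit.BirchSwinnertonDyer.BirchSwinnertonDyer.Theorems.FlatTwist.Family

/-! ## §1. The conductor of a square-free twist of a `p²`-anchor is `≡ 1 (mod 8)` -/

section LevelSixteen

variable (W : WeierstrassCurve ℚ) [W.IsElliptic] [W.IsGloballyMinimal] [NeZero (W.conductorNorm ℤ)]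
  {d₁ : ℤ} {A₁ : WeierstrassCurve ℚ} [A₁.IsElliptic] [A₁.IsGloballyMinimal] [NeZero (A₁.conductorNorm ℤ)]
  {f₁ : CuspForm (Gamma0 (A₁.conductorNorm ℤ)) 2}

omit [W.IsGloballyMinimal] [NeZero (W.conductorNorm ℤ)] [A₁.IsGloballyMinimal] [NeZero (A₁.conductorNorm ℤ)] in
/-- **`N_{A₁} ≡ 1 (mod 8)`** for `A₁ = C₁ • W^{(d₁)}` globally minimal, `d₁ ≡ 1 (mod 4)` square-free prime to `N_W = p²` with
`p` odd: `N_{A₁} = p²·d₁²` (Atkin–Lehner, tree `conductorNorm_twist_eq`, granted modularity) and odd squares are `≡ 1 (mod 8)`.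
[cite: AtkinLehner1970, §6] -/
theorem conductorNorm_twist_mod_eight (hmod : exists_isNewformOf) {p : ℕ} (hp : Odd p)
    (hNW : W.conductorNorm ℤ = p ^ 2) (hd4 : d₁ % 4 = 1) (hsq₁ : Squarefree d₁)
    (hcop₁ : IsCoprime d₁ (W.conductorNorm ℤ : ℤ)) {C₁ : VariableChange ℚ} (hA₁ : C₁ • W.quadraticTwist (d₁ : ℚ) = A₁) :
    A₁.conductorNorm ℤ % 8 = 1 := by
  have hdodd : Odd d₁.natAbs := Int.natAbs_odd.mpr (Int.odd_iff.mpr (by omega))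
  rw [conductorNorm_twist_eq W hmod hd4 hsq₁ hcop₁ hA₁, hNW, Nat.mul_mod, ModularForms.sq_mod_eight_of_odd hp,
    ModularForms.sq_mod_eight_of_odd hdodd]

/-! ## §2. The level-16 plus certificate at a sibling, from print and `ord₂(#Ш·∏c) = 1` -/

omit [NeZero (W.conductorNorm ℤ)] in
/-- **LEVEL-16 CERTIFICATE AT A SIBLING.** Anchor `W` (globally minimal, good supersingular at `2` with `a₂(W) = 0`, conductor
`p²`); sibling `A₁ = C₁ • W^{(d₁)}` globally minimal, `d₁` square-free with `p ∤ d₁`, CM, of analytic rank `0`, good supersingular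
at `2`, with `ord₂ #Ш(A₁) + ord₂ ∏c_ℓ(A₁) = 1`, newform `f₁`. Granted BY NAME `hBF hLrat hGZK` and Abbes–Ullmo (period unit at
`2`): some `[b/4^k]⁺_{f₁} − [0]⁺_{f₁}` (`k ≥ 1`, `b` odd) is half an odd integer — `ord₂[0]⁺_{f₁} = 1` by the BSD formula in the
CM rank-`0` case, `N_{A₁} ≡ 1 (mod 8)` (§1, `d₁ ≡ 1 (mod 4)` derived), Fricke sign `−1` as `w(A₁) = +1`, and
`FlatLevelSixteen.exists_odd_sixteenth_of_padicValRat_eq_one`. [cite: BurungaleFlach2024, Thm. 1.1] [cite: AtkinLehner1970, Thm. 3]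
[cite: AbbesUllmo1996, Thm. A] [cite: MazurTateTeitelbaum1986Invent, §I.4 (4.2), §I.8] -/
theorem levelSixteen_certificate_of_sibling
    (hBF : bsdTriple_of_hasCM_of_L_one_ne_zero) (hmod : exists_isNewformOf) (hLrat : hasEntireLFunction_rat)
    (hGZK : rank_eq_analyticRank_of_analyticRank_le_one) (hAU : abbesUllmo_not_dvd_maninConstant_of_not_dvd_level)
    {p : ℕ} (hp : p.Prime) (hNW : W.conductorNorm ℤ = p ^ 2) (hss : GoodSS W 2) (haW : W.frobeniusTrace 2 = 0)
    (hsq₁ : Squarefree d₁) (hpd₁ : ¬ (p : ℤ) ∣ d₁) {C₁ : VariableChange ℚ} (hA₁ : C₁ • W.quadraticTwist (d₁ : ℚ) = A₁)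
    (hcm₁ : A₁.HasCM) (hr₁ : A₁.analyticRank = 0) (hss₁ : GoodSS A₁ 2)
    (hz₁ : padicValNat 2 A₁.shaOrder + padicValNat 2 A₁.tamagawaProduct = 1) (hf₁ : IsNewformOf A₁ f₁) :
    ∃ k : ℕ, 1 ≤ k ∧ ∃ b : ℤ, Odd b ∧ ∃ m : ℤ, Odd m ∧
      ratPlusSymbol f₁ ((b : ℚ) / 4 ^ k) = ratPlusSymbol f₁ 0 + (m : ℚ) / 2 := by
  have h2 := SkinnerUrban2014.realPeriodRat_eq_unit_mul_plusPeriod_two_fact_of_abbesUllmo hAU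
  have hcop₁ : IsCoprime d₁ (W.conductorNorm ℤ : ℤ) := isCoprime_natCast_of_not_dvd_of_eq_sq hp hpd₁ hNW
  have hd4 : d₁ % 4 = 1 := emod_four_eq_one_of_hasGoodReductionAtPrime_two W hsq₁ hA₁ hss.1 hss₁.1
  -- `p` is odd: `2 ∤ N_W = p²` as `W` is good at `2`
  have h2NW : ¬ 2 ∣ W.conductorNorm ℤ := fun h ↦ (W.dvd_conductorNorm_iff_not_hasGoodReductionAtPrime 2).mp h hss.1
  have hpodd : Odd p := by
    refine hp.odd_of_ne_two ?_
    rintro rfl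
    exact h2NW (by rw [hNW]; exact dvd_pow_self 2 two_ne_zero)
  have hN8 : A₁.conductorNorm ℤ % 8 = 1 := conductorNorm_twist_mod_eight W hmod hpodd hNW hd4 hsq₁ hcop₁ hA₁
  -- `a₂(A₁) = 0`, Fricke sign, level prime to `2`
  have h2d₁ : ¬ (2 : ℤ) ∣ d₁ := by omega
  have ha₁ : A₁.frobeniusTrace 2 = 0 := by
    rw [(hasGoodReductionAtPrime_twist_and_frobeniusTrace_eq W 2 hmod hd4 hsq₁ hcop₁ hA₁ hss.1 h2d₁).2, haW, mul_zero]
  have hL₁ : A₁.entireLFunction 1 ≠ 0 := (A₁.analyticRank_eq_zero_iff_holds (hLrat A₁)).mp hr₁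
  have hw₁ : A₁.rootNumber = 1 := WeierstrassCurve.rootNumber_eq_one_of_entireLFunction_one_ne_zero hL₁
  have hFr : IsFrickeEigen (A₁.conductorNorm ℤ) f₁ (-((1 : ℤ) : ℂ)) := by
    have h := hf₁.isFrickeEigen_neg_rootNumber
    rwa [hw₁] at h
  have hap : cuspCoeff f₁ 2 = ((0 : ℤ) : ℂ) := by
    rw [cuspCoeff_eq_frobeniusTrace_of_isNewformOf_holds hf₁ hss₁.1, ha₁]
  have h2N : ¬ 2 ∣ A₁.conductorNorm ℤ := not_dvd_level_of_isNewformOf hf₁ hss₁.1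
  have hv : padicValRat 2 (ratPlusSymbol f₁ 0) = 1 := by
    rw [FlatLevelSixteen.padicValRat_ratPlusSymbol_zero_eq_of_pub A₁ hBF hLrat hGZK h2 hcm₁ hr₁ hss₁ hf₁]
    exact_mod_cast hz₁
  exact FlatLevelSixteen.exists_odd_sixteenth_of_padicValRat_eq_one hf₁.1 hf₁.coeffField_eq_bot h2N hap hFr (Or.inl hN8) hv

end LevelSixteen

/-! ## §3. The family node from print and the BSD data of two siblings -/

section Family

variable {p : ℕ} (W W' : WeierstrassCurve ℚ) [W.IsElliptic] [W.IsGloballyMinimal] [W'.IsElliptic] [W'.IsGloballyMinimal]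
  [NeZero (W.conductorNorm ℤ)] [NeZero (W'.conductorNorm ℤ)]
  {fW : CuspForm (Gamma0 (W.conductorNorm ℤ)) 2} {fW' : CuspForm (Gamma0 (W'.conductorNorm ℤ)) 2}
  {d₁ : ℤ} {A₁ : WeierstrassCurve ℚ} [A₁.IsElliptic] [A₁.IsGloballyMinimal] [NeZero (A₁.conductorNorm ℤ)]
  {d₂ : ℤ} {A₂ : WeierstrassCurve ℚ} [A₂.IsElliptic] [A₂.IsGloballyMinimal] [NeZero (A₂.conductorNorm ℤ)]

/-- **FLAT ON A WHOLE `j`-FAMILY FROM PRINT AND THE BSD DATA OF TWO RANK-ZERO MEMBERS.** Grant BY NAME Burungale–Flach (`hBF`),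
modularity (`hmod`, `hLrat`), GZK (`hGZK`), Abbes–Ullmo (`hAU`). Anchor pair `W`, `W′ = C′ • W^{(q)}` (`q = ±p`, `p` prime):
globally minimal, good supersingular at `2` with `a₂ = 0`, `Δ < 0`, conductor `p²`, newforms `f_W`, `f_{W′}`, `j(W) ≠ 0, 1728`.
LEVEL-16 SIBLINGS: `A₁ = C₁ • W^{(d₁)}`, `A₂ = C₂ • W′^{(d₂)}` globally minimal, CM, of analytic rank `0`, good supersingular at
`2`, `d_i` square-free with `p ∤ d_i`, and `ord₂ #Ш(A_i) + ord₂ ∏c_ℓ(A_i) = 1`. THEN the registered stub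
`stub_analyticMuFlatNonUnitCMTwo` (= FLAT) holds RESTRICTED TO THE FAMILY `j(A) = j(W)`, binders verbatim after `A.j = W.j →`
(`analyticMuFlat_of_j_eq_of_siblings` fed with `levelSixteen_certificate_of_sibling`). Census reading (not asserted): for
`p = 11` the class `1089e = 121b ⊗ (−3/·)` and for `p = 19` the class `17689d = 361a ⊗ (−7/·)` have `∏c = 2`, `Ш_an = 1`.
Nothing about any particular curve is asserted; BSD is not proved by this.
[cite: BurungaleFlach2024, Thm. 1.1] [cite: AtkinLehner1970, Thm. 3, §6] [cite: SilvermanAEC2009, X.5 Prop. 5.4]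
[cite: BarriosEtAl2025, Thm. 5.1, rows I₀] [cite: AbbesUllmo1996, Thm. A] [cite: Pollack2003, Prop. 6.18] -/
theorem analyticMuFlat_family_of_pub_of_levelSixteen_siblings
    (hBF : bsdTriple_of_hasCM_of_L_one_ne_zero) (hmod : nonempty_modularParametrizationData)
    (hLrat : hasEntireLFunction_rat) (hGZK : rank_eq_analyticRank_of_analyticRank_le_one)
    (hAU : abbesUllmo_not_dvd_maninConstant_of_not_dvd_level) (hp : p.Prime) {q : ℤ} (hq : q = p ∨ q = -(p : ℤ))
    (hss : GoodSS W 2) (haW : W.frobeniusTrace 2 = 0) (hΔ : W.Δ < 0) (hj0 : W.j ≠ 0) (hj1728 : W.j ≠ 1728)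
    (hNW : W.conductorNorm ℤ = p ^ 2) (hfW : IsNewformOf W fW)
    (hsq₁ : Squarefree d₁) (hpd₁ : ¬ (p : ℤ) ∣ d₁) {C₁ : VariableChange ℚ} (hA₁ : C₁ • W.quadraticTwist (d₁ : ℚ) = A₁)
    (hcm₁ : A₁.HasCM) (hr₁ : A₁.analyticRank = 0) (hss₁ : GoodSS A₁ 2)
    (hz₁ : padicValNat 2 A₁.shaOrder + padicValNat 2 A₁.tamagawaProduct = 1)
    {C' : VariableChange ℚ} (hW' : C' • W.quadraticTwist (q : ℚ) = W')
    (hss' : GoodSS W' 2) (haW' : W'.frobeniusTrace 2 = 0) (hΔ' : W'.Δ < 0)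
    (hNW' : W'.conductorNorm ℤ = p ^ 2) (hfW' : IsNewformOf W' fW')
    (hsq₂ : Squarefree d₂) (hpd₂ : ¬ (p : ℤ) ∣ d₂) {C₂ : VariableChange ℚ} (hA₂ : C₂ • W'.quadraticTwist (d₂ : ℚ) = A₂)
    (hcm₂ : A₂.HasCM) (hr₂ : A₂.analyticRank = 0) (hss₂ : GoodSS A₂ 2)
    (hz₂ : padicValNat 2 A₂.shaOrder + padicValNat 2 A₂.tamagawaProduct = 1) :
    ∀ (A : WeierstrassCurve ℚ) [A.IsElliptic] [A.IsGloballyMinimal], A.j = W.j → A.HasCM → A.analyticRank = 0 →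
      GoodSS A 2 → A.frobeniusTrace 2 = 0 → 2 ∣ A.shaOrder * A.tamagawaProduct →
      ∀ [NeZero (A.conductorNorm ℤ)] (f : CuspForm (Gamma0 (A.conductorNorm ℤ)) 2), IsNewformOf A f →
        ∀ (Lplus Lminus : IwasawaAlgebra 2), IsPollackPair f 2 Lplus Lminus →
          ∃ n : ℕ, IsUnit (PowerSeries.coeff n (kobayashiL 1 Lplus Lminus)) := by
  intro A _ _ hjA _ hrA hssA _ _ _ f hf Lplus Lminus hPP
  have hmod' : exists_isNewformOf := exists_isNewformOf_of_nonempty_modularParametrizationData hmod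
  have hLA : A.entireLFunction 1 ≠ 0 := (A.analyticRank_eq_zero_iff_holds (hLrat A)).mp hrA
  have hL₁ : A₁.entireLFunction 1 ≠ 0 := (A₁.analyticRank_eq_zero_iff_holds (hLrat A₁)).mp hr₁
  have hL₂ : A₂.entireLFunction 1 ≠ 0 := (A₂.analyticRank_eq_zero_iff_holds (hLrat A₂)).mp hr₂
  obtain ⟨f₁, hf₁⟩ := hmod' A₁
  obtain ⟨f₂, hf₂⟩ := hmod' A₂
  have hres₁ := levelSixteen_certificate_of_sibling W hBF hmod' hLrat hGZK hAU hp hNW hss haW hsq₁ hpd₁ hA₁ hcm₁ hr₁ hss₁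
    hz₁ hf₁
  have hres₂ := levelSixteen_certificate_of_sibling W' hBF hmod' hLrat hGZK hAU hp hNW' hss' haW' hsq₂ hpd₂ hA₂ hcm₂ hr₂
    hss₂ hz₂ hf₂
  exact analyticMuFlat_of_j_eq_of_siblings W W' hmod' hAU hp hq hss haW hΔ hj0 hj1728 hNW hfW hsq₁ hpd₁ hA₁ hss₁.1 hf₁
    hL₁ hres₁ hW' hss' haW' hΔ' hNW' hfW' hsq₂ hpd₂ hA₂ hss₂.1 hf₂ hL₂ hres₂ hjA hssA.1 hf hLA Lplus Lminus hPP

end Family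

end Summit.BirchSwinnertonDyer.BirchSwinnertonDyer.Theorems.FlatTwist.Family

end
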